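import Summits.Ventures.LatticeQCDFlow.Scoring.InfiniteVolumeLimit2D
import Summits.Ventures.LatticeQCDFlow.Scoring.OnePlaquetteHaarMGF
import HarnessLib

/-!
# The exact non-abelian area law in two dimensions, V-q: NO PHASE TRANSITION IN TWO DIMENSIONS — every local expectation of the infinite-volume state is real-analytic in `β` on all of `ℝ`

HONEST FRAMING: exact (Metropolis-corrected) sampling algorithms for lattice gauge theory;
figures of merit are autocorrelation/cost numbers at stated couplings and volumes; no
continuum-physics claim.

Venture `LatticeQCDFlow` (cell pub-lqcd), sub-topic `Scoring`; FANOUT row 5 (`s0-sun-a`), GEN-19.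
NEW WORK of the cell (placement rule).  Every compact metrisable `G`, continuous `ρ`; `F` a bounded continuous cylinder
observable of `G^{edges(ℤ²)}`.  By V-j/V-k the thermodynamic limit of `⟨F ∘ torusLift⟩_{(ℤ/(L+1))²,β}` exists for every
`β` and equals the free-boundary expectation, which is `g_F(β) = ∫ F(ū) e^{β S(u)} dHaar^{⊗E'} / ∫ e^{β S(u)} dHaar^{⊗E'}`
with `S(u) = Σ_{z ∈ box} Re tr ρ(ū_z)` — a ratio of weighted moment generating functions of the bounded observable `S`.

* §1 `integral_mul_exp_eq_mgf_withDensity`, `analyticOnNhd_integral_mul_exp_mul` — `t ↦ ∫ h e^{tX} dν` is real-analytic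
  on `ℝ` for bounded measurable `X` and bounded measurable `h` (Mathlib's analyticity of `mgf` — GEN-17's
  `analyticOnNhd_mgf_univ` — for `ν` with density `h^±`);
* §2 **`analytic_torusLocalLimit_two_of_box`**, **`exists_analytic_torusLocalLimit_two`** — for every bounded continuous
  cylinder observable there is `g : ℝ → ℝ`, REAL-ANALYTIC ON ALL OF `ℝ`, with `⟨F ∘ torusLift⟩_{(ℤ/(L+1))²,β} → g(β)` for
  EVERY real `β`: the shape of the Osterwalder–Seiler core fact `osterwalder_seiler_torusLocalLimit` (there for
  `0 ≤ β < β₀` by the cluster expansion) with NO restriction on the coupling; **`exists_analytic_integral_eq_two`** — the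
  infinite-volume expectation `β ↦ ∫ F dμ_β` of every bounded continuous local observable is one real-analytic function
  on `ℝ`: TWO-DIMENSIONAL LATTICE YANG–MILLS HAS NO PHASE TRANSITION (analyticity of all local expectations) AT ANY
  COUPLING, FOR ANY COMPACT METRISABLE GAUGE GROUP AND ANY CONTINUOUS REPRESENTATION.

(The Gross–Witten third-order transition of `U(N)` is an `N = ∞` statement about the free energy; at every finite `N`
all local expectations are analytic in `β`, as here.)  No `def`, nothing cited as a fact, 0 sorry.
-/

noncomputable section

open MeasureTheory ProbabilityTheory Function Finset Filter Topology
open Literature.MathematicalPhysics.QuantumFieldTheory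
open Literature.MathematicalPhysics.QuantumLattice
open Summit.Ventures.LatticeQCDFlow.Theory2.Lattice
open Summit.Ventures.LatticeQCDFlow.Theory2.Lattice.TwoDim

namespace Summit.Ventures.LatticeQCDFlow.Scoring


/-! ## §1. Weighted moment generating functions of a bounded observable are entire -/

section WeightedMGF

variable {Ω : Type*} [MeasurableSpace Ω] {ν : Measure Ω} [IsFiniteMeasure ν] {X h : Ω → ℝ} {C D : ℝ}

omit [IsFiniteMeasure ν] in
/-- `∫ h e^{tX} dν` is the moment generating function of `X` under `h dν` (`h ≥ 0` measurable). -/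
theorem integral_mul_exp_eq_mgf_withDensity (hh : Measurable h) (hh0 : ∀ ω, 0 ≤ h ω) (t : ℝ) :
    ∫ ω, h ω * Real.exp (t * X ω) ∂ν = mgf X (ν.withDensity fun ω => ENNReal.ofReal (h ω)) t := by
  rw [mgf, integral_withDensity_eq_integral_toReal_smul hh.ennreal_ofReal
    (ae_of_all _ fun _ => ENNReal.ofReal_lt_top)]
  refine integral_congr_ae (ae_of_all _ fun ω => ?_)
  show h ω * Real.exp (t * X ω) = (ENNReal.ofReal (h ω)).toReal • Real.exp (t * X ω)
  rw [ENNReal.toReal_ofReal (hh0 ω), smul_eq_mul]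

/-- `t ↦ ∫ h e^{tX} dν` is real-analytic on `ℝ` for bounded measurable `X` and bounded measurable `h ≥ 0`. -/
theorem analyticOnNhd_integral_mul_exp_mul_of_nonneg (hXm : Measurable X) (hC : ∀ ω, |X ω| ≤ C)
    (hh : Measurable h) (hh0 : ∀ ω, 0 ≤ h ω) (hD : ∀ ω, h ω ≤ D) :
    AnalyticOnNhd ℝ (fun t => ∫ ω, h ω * Real.exp (t * X ω) ∂ν) Set.univ := by
  haveI : IsFiniteMeasure (ν.withDensity fun ω => ENNReal.ofReal (h ω)) :=
    isFiniteMeasure_withDensity_ofReal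
      (Integrable.of_mem_Icc 0 D hh.aemeasurable (ae_of_all _ fun ω => ⟨hh0 ω, hD ω⟩)).hasFiniteIntegral
  have h1 := analyticOnNhd_mgf_univ (μ := ν.withDensity fun ω => ENNReal.ofReal (h ω))
    hXm.aestronglyMeasurable hC
  have heq : (fun t => ∫ ω, h ω * Real.exp (t * X ω) ∂ν) =
      mgf X (ν.withDensity fun ω => ENNReal.ofReal (h ω)) :=
    funext fun t => integral_mul_exp_eq_mgf_withDensity hh hh0 t
  rw [heq]
  exact h1

/-- Integrability of `k e^{tX}` for bounded measurable `k`, `X`. -/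
theorem integrable_mul_exp_mul_of_abs_le (hXm : Measurable X) (hC : ∀ ω, |X ω| ≤ C) {k : Ω → ℝ}
    (hk : Measurable k) (hkD : ∀ ω, |k ω| ≤ D) (t : ℝ) :
    Integrable (fun ω => k ω * Real.exp (t * X ω)) ν := by
  refine Integrable.of_mem_Icc (-(D * Real.exp (|t| * C))) (D * Real.exp (|t| * C))
    ((hk.mul (Real.measurable_exp.comp (hXm.const_mul t))).aemeasurable) (ae_of_all _ fun ω => ?_)
  have he : Real.exp (t * X ω) ≤ Real.exp (|t| * C) := Real.exp_le_exp.2 (by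
    calc t * X ω ≤ |t * X ω| := le_abs_self _
      _ = |t| * |X ω| := abs_mul _ _
      _ ≤ |t| * C := mul_le_mul_of_nonneg_left (hC ω) (abs_nonneg _))
  have he0 : 0 < Real.exp (t * X ω) := Real.exp_pos _
  have hk' := abs_le.1 (hkD ω)
  constructor <;> nlinarith [hk'.1, hk'.2, he, he0]

/-- `t ↦ ∫ h e^{tX} dν` is real-analytic on `ℝ` for bounded measurable `X` and bounded measurable (signed) `h`
(`h = h⁺ − h⁻`). -/
theorem analyticOnNhd_integral_mul_exp_mul (hXm : Measurable X) (hC : ∀ ω, |X ω| ≤ C) (hh : Measurable h)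
    (hD : ∀ ω, |h ω| ≤ D) :
    AnalyticOnNhd ℝ (fun t => ∫ ω, h ω * Real.exp (t * X ω) ∂ν) Set.univ := by
  have hpD : ∀ ω, |max (h ω) 0| ≤ D := fun ω => by
    rw [abs_of_nonneg (le_max_right _ _)]
    exact max_le ((le_abs_self _).trans (hD ω)) ((abs_nonneg _).trans (hD ω))
  have hnD : ∀ ω, |max (-h ω) 0| ≤ D := fun ω => by
    rw [abs_of_nonneg (le_max_right _ _)]
    exact max_le ((neg_le_abs _).trans (hD ω)) ((abs_nonneg _).trans (hD ω))
  have hmp : Measurable fun ω => max (h ω) 0 := hh.max measurable_const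
  have hmn : Measurable fun ω => max (-h ω) 0 := hh.neg.max measurable_const
  have hp := analyticOnNhd_integral_mul_exp_mul_of_nonneg (ν := ν) (h := fun ω => max (h ω) 0) hXm hC hmp
    (fun ω => le_max_right _ _) (fun ω => (le_abs_self _).trans (hpD ω))
  have hn := analyticOnNhd_integral_mul_exp_mul_of_nonneg (ν := ν) (h := fun ω => max (-h ω) 0) hXm hC hmn
    (fun ω => le_max_right _ _) (fun ω => (le_abs_self _).trans (hnD ω))
  have hi1 : ∀ t : ℝ, Integrable (fun ω => max (h ω) 0 * Real.exp (t * X ω)) ν := fun t =>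
    integrable_mul_exp_mul_of_abs_le hXm hC (k := fun ω => max (h ω) 0) hmp hpD t
  have hi2 : ∀ t : ℝ, Integrable (fun ω => max (-h ω) 0 * Real.exp (t * X ω)) ν := fun t =>
    integrable_mul_exp_mul_of_abs_le hXm hC (k := fun ω => max (-h ω) 0) hmn hnD t
  have heq : (fun t => ∫ ω, h ω * Real.exp (t * X ω) ∂ν) = fun t =>
      (∫ ω, max (h ω) 0 * Real.exp (t * X ω) ∂ν) - ∫ ω, max (-h ω) 0 * Real.exp (t * X ω) ∂ν := by
    funext t
    rw [← integral_sub (hi1 t) (hi2 t)]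
    refine integral_congr_ae (ae_of_all _ fun ω => ?_)
    show h ω * Real.exp (t * X ω) = max (h ω) 0 * Real.exp (t * X ω) - max (-h ω) 0 * Real.exp (t * X ω)
    rw [← sub_mul, max_zero_sub_max_neg_zero_eq_self]
  rw [heq]
  exact hp.sub hn

end WeightedMGF

/-! ## §2. Analyticity in the coupling of the thermodynamic limit of every local observable -/

section Analytic

variable {G : Type*} [Group G] [TopologicalSpace G] [IsTopologicalGroup G]
  [CompactSpace G] [T2Space G] [SecondCountableTopology G] [MeasurableSpace G] [BorelSpace G] {N : ℕ}
  (ρ : G →* Matrix (Fin N) (Fin N) ℂ)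

omit [T2Space G] in
/-- **ANALYTICITY OF THE THERMODYNAMIC LIMIT IN THE COUPLING, EXPLICIT BOX FORM.**  For a bounded continuous cylinder
observable `F` supported over an `R × T` box (edge set `E' ⊇ S` containing the box's links) there is `g : ℝ → ℝ`,
real-analytic on all of `ℝ` — namely `g(β) = ∫ F(ū) e^{β S(u)} dHaar^{⊗E'} / ∫ e^{β S(u)} dHaar^{⊗E'}`,
`S(u) = Σ_{z∈box} Re tr ρ(ū_z)` — with `⟨F ∘ torusLift⟩_{(ℤ/(L+1))²,β} → g(β)` for EVERY real `β`. -/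
theorem analytic_torusLocalLimit_two_of_box (hρ : Continuous ρ) {F : LGConfig 2 G → ℝ}
    {S E' : Finset ((Literature.MathematicalPhysics.QuantumLattice.ZdEdge 2))} (hFS : IsCylinder F S) (hFc : Continuous F) {C : ℝ} (hFb : ∀ U, |F U| ≤ C)
    (hSE : S ⊆ E') {a b : ℤ} {R T : ℕ}
    (hS : ∀ s ∈ S, s.1 ∈ (range R ×ˢ range T).image (fun q : ℕ × ℕ => (![a + q.1, b + q.2] : (Literature.Probability.LatticeModels.Site 2))))
    (hE : ∀ z ∈ (range R ×ˢ range T).image (fun q : ℕ × ℕ => (![a + q.1, b + q.2] : (Literature.Probability.LatticeModels.Site 2))),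
      ((z, 0) : (Literature.MathematicalPhysics.QuantumLattice.ZdEdge 2)) ∈ E' ∧ ((z + Pi.single 0 1, 1) : (Literature.MathematicalPhysics.QuantumLattice.ZdEdge 2)) ∈ E' ∧
        ((z + Pi.single 1 1, 0) : (Literature.MathematicalPhysics.QuantumLattice.ZdEdge 2)) ∈ E' ∧ ((z, 1) : (Literature.MathematicalPhysics.QuantumLattice.ZdEdge 2)) ∈ E') :
    ∃ g : ℝ → ℝ, AnalyticOnNhd ℝ g Set.univ ∧ ∀ β : ℝ,
      Tendsto (fun L : ℕ => wilsonExpectation (L := L + 1) ρ β (toTorusObservable (L + 1) F)) atTop (𝓝 (g β)) := by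
  obtain ⟨B, hB0, hB⟩ := exists_bound_trace_re_nonneg ρ hρ
  -- the observable `S(u) = Σ_{z∈box} Re tr ρ(ū_z)` on `G^{E'}` and the transported `F`
  set Ssum : (↥E' → G) → ℝ := fun u =>
    ∑ z ∈ (range R ×ˢ range T).image (fun q : ℕ × ℕ => (![a + q.1, b + q.2] : (Literature.Probability.LatticeModels.Site 2))),
      (ρ (plaquetteHolonomyZd (padConfig E' u) z 0 1)).trace.re with hSsum
  have hpad : Continuous (padConfig (G := G) E') := continuous_padConfig E'
  have hholp : ∀ z : (Literature.Probability.LatticeModels.Site 2), Continuous fun u : ↥E' → G => plaquetteHolonomyZd (padConfig E' u) z 0 1 := by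
    intro z
    unfold plaquetteHolonomyZd
    fun_prop
  have htr : Continuous fun g : G => (ρ g).trace.re := Complex.continuous_re.comp hρ.matrix_trace
  have hSc : Continuous Ssum := continuous_finsetSum _ fun z _ => htr.comp (hholp z)
  have hSb : ∀ u, |Ssum u| ≤
      ((range R ×ˢ range T).image (fun q : ℕ × ℕ => (![a + q.1, b + q.2] : (Literature.Probability.LatticeModels.Site 2)))).card * B := fun u => by
    calc |Ssum u| ≤ ∑ z ∈ (range R ×ˢ range T).image (fun q : ℕ × ℕ => (![a + q.1, b + q.2] : (Literature.Probability.LatticeModels.Site 2))),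
          |(ρ (plaquetteHolonomyZd (padConfig E' u) z 0 1)).trace.re| := Finset.abs_sum_le_sum_abs _ _
      _ ≤ ∑ _z ∈ (range R ×ˢ range T).image (fun q : ℕ × ℕ => (![a + q.1, b + q.2] : (Literature.Probability.LatticeModels.Site 2))), B :=
          Finset.sum_le_sum fun z _ => hB _
      _ = _ := by rw [Finset.sum_const, nsmul_eq_mul]
  have hFpc : Continuous fun u : ↥E' → G => F (padConfig E' u) := hFc.comp hpad
  -- the analytic function
  refine ⟨fun β => (∫ u, F (padConfig E' u) * Real.exp (β * Ssum u)
      ∂(Measure.pi fun _ : ↥E' => haarProbability G)) /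
    ∫ u, Real.exp (β * Ssum u) ∂(Measure.pi fun _ : ↥E' => haarProbability G), ?_, fun β => ?_⟩
  · have hnum := analyticOnNhd_integral_mul_exp_mul (ν := Measure.pi fun _ : ↥E' => haarProbability G)
      hSc.measurable hSb hFpc.measurable fun u => hFb _
    have hden : AnalyticOnNhd ℝ (fun β => ∫ u, Real.exp (β * Ssum u)
        ∂(Measure.pi fun _ : ↥E' => haarProbability G)) Set.univ :=
      analyticOnNhd_mgf_univ (μ := Measure.pi fun _ : ↥E' => haarProbability G) hSc.aestronglyMeasurable hSb
    exact hnum.div hden fun β _ =>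
      (integral_exp_pos (integrable_exp_mul_of_abs_le_const hSc.aestronglyMeasurable hSb β)).ne'
  · have h := tendsto_wilsonExpectation_cylinder_of_box ρ hρ β hFS hFc hFb hSE hS hE
    -- the free-boundary ratio of V-j is this ratio: the constant `e^{−βN·#box}` cancels
    have hsplit : ∀ u : ↥E' → G,
        ∏ z ∈ (range R ×ˢ range T).image (fun q : ℕ × ℕ => (![a + q.1, b + q.2] : (Literature.Probability.LatticeModels.Site 2))),
          Real.exp (-(β * ((N : ℝ) - (ρ (plaquetteHolonomyZd (padConfig E' u) z 0 1)).trace.re))) =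
          Real.exp (-(β * N *
            ((range R ×ˢ range T).image (fun q : ℕ × ℕ => (![a + q.1, b + q.2] : (Literature.Probability.LatticeModels.Site 2)))).card)) *
            Real.exp (β * Ssum u) := by
      intro u
      rw [← Real.exp_add, ← Real.exp_sum]
      congr 1
      rw [hSsum, Finset.mul_sum, show -(β * N *
          (((range R ×ˢ range T).image (fun q : ℕ × ℕ => (![a + q.1, b + q.2] : (Literature.Probability.LatticeModels.Site 2)))).card : ℝ)) =
          ∑ _z ∈ (range R ×ˢ range T).image (fun q : ℕ × ℕ => (![a + q.1, b + q.2] : (Literature.Probability.LatticeModels.Site 2))), -(β * N) by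
            rw [Finset.sum_const, nsmul_eq_mul]; ring,
        ← Finset.sum_add_distrib]
      exact Finset.sum_congr rfl fun z _ => by ring
    simp_rw [hsplit] at h
    have e1 : ∫ u, F (padConfig E' u) * (Real.exp (-(β * N *
          ((range R ×ˢ range T).image (fun q : ℕ × ℕ => (![a + q.1, b + q.2] : (Literature.Probability.LatticeModels.Site 2)))).card)) *
          Real.exp (β * Ssum u)) ∂(Measure.pi fun _ : ↥E' => haarProbability G) =
        Real.exp (-(β * N *
          ((range R ×ˢ range T).image (fun q : ℕ × ℕ => (![a + q.1, b + q.2] : (Literature.Probability.LatticeModels.Site 2)))).card)) *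
          ∫ u, F (padConfig E' u) * Real.exp (β * Ssum u) ∂(Measure.pi fun _ : ↥E' => haarProbability G) := by
      rw [← integral_const_mul]
      refine integral_congr_ae (ae_of_all _ fun u => ?_)
      ring
    rw [e1, integral_const_mul, mul_div_mul_left _ _ (Real.exp_pos _).ne'] at h
    exact h

omit [T2Space G] in
/-- **FOR EVERY BOUNDED CONTINUOUS CYLINDER OBSERVABLE THE THERMODYNAMIC LIMIT IS A REAL-ANALYTIC FUNCTION OF THE COUPLING
ON ALL OF `ℝ`** (two-dimensional lattice Yang–Mills, every compact metrisable gauge group, continuous `ρ`):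
`∃ g`, `AnalyticOnNhd ℝ g univ`, `⟨F ∘ torusLift⟩_{(ℤ/(L+1))²,β} → g(β)` for every real `β`. -/
theorem exists_analytic_torusLocalLimit_two (hρ : Continuous ρ) {F : LGConfig 2 G → ℝ} {S : Finset ((Literature.MathematicalPhysics.QuantumLattice.ZdEdge 2))}
    (hFS : IsCylinder F S) (hFc : Continuous F) (hFb : ∃ C, ∀ U, |F U| ≤ C) :
    ∃ g : ℝ → ℝ, AnalyticOnNhd ℝ g Set.univ ∧ ∀ β : ℝ,
      Tendsto (fun L : ℕ => wilsonExpectation (L := L + 1) ρ β (toTorusObservable (L + 1) F)) atTop (𝓝 (g β)) := by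
  classical
  obtain ⟨C, hC⟩ := hFb
  -- a box containing the support (as in `exists_tendsto_wilsonExpectation_cylinder`)
  set M : ℕ := S.sup fun s => Finset.univ.sup fun i : Fin 2 => (s.1 i).natAbs with hM
  have hMle : ∀ s ∈ S, ∀ i, |s.1 i| ≤ (M : ℤ) := fun s hs i => by
    rw [Int.abs_eq_natAbs, Int.ofNat_le]
    exact (Finset.le_sup (f := fun i : Fin 2 => (s.1 i).natAbs) (Finset.mem_univ i)).trans
      (Finset.le_sup (f := fun s : (Literature.MathematicalPhysics.QuantumLattice.ZdEdge 2) => Finset.univ.sup fun i : Fin 2 => (s.1 i).natAbs) hs)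
  have hS : ∀ s ∈ S, s.1 ∈ (range (2 * M + 1) ×ˢ range (2 * M + 1)).image
      (fun q : ℕ × ℕ => (![-(M : ℤ) + q.1, -(M : ℤ) + q.2] : (Literature.Probability.LatticeModels.Site 2))) := fun s hs => by
    have h0 := abs_le.1 (hMle s hs 0)
    have h1 := abs_le.1 (hMle s hs 1)
    refine Finset.mem_image.2 ⟨((s.1 0 + M).toNat, (s.1 1 + M).toNat),
      Finset.mem_product.2 ⟨Finset.mem_range.2 (by omega), Finset.mem_range.2 (by omega)⟩, ?_⟩
    funext k
    have h01 : ∀ k : Fin 2, k = 0 ∨ k = 1 := by decide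
    rcases h01 k with rfl | rfl
    · simp only [Matrix.cons_val_zero]
      omega
    · simp only [Matrix.cons_val_one, Matrix.cons_val_fin_one]
      omega
  set Box : Finset (Literature.Probability.LatticeModels.Site 2) := (range (2 * M + 1) ×ˢ range (2 * M + 1)).image
    (fun q : ℕ × ℕ => (![-(M : ℤ) + q.1, -(M : ℤ) + q.2] : (Literature.Probability.LatticeModels.Site 2))) with hBox
  set E' : Finset ((Literature.MathematicalPhysics.QuantumLattice.ZdEdge 2)) :=
    (Box ∪ Box.image (· + Pi.single 0 1) ∪ Box.image (· + Pi.single 1 1)) ×ˢ Finset.univ with hE'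
  have hSE : S ⊆ E' := fun s hs =>
    Finset.mem_product.2 ⟨Finset.mem_union_left _ (Finset.mem_union_left _ (hS s hs)), Finset.mem_univ _⟩
  have hE : ∀ z ∈ Box, ((z, 0) : (Literature.MathematicalPhysics.QuantumLattice.ZdEdge 2)) ∈ E' ∧ ((z + Pi.single 0 1, 1) : (Literature.MathematicalPhysics.QuantumLattice.ZdEdge 2)) ∈ E' ∧
      ((z + Pi.single 1 1, 0) : (Literature.MathematicalPhysics.QuantumLattice.ZdEdge 2)) ∈ E' ∧ ((z, 1) : (Literature.MathematicalPhysics.QuantumLattice.ZdEdge 2)) ∈ E' := fun z hz =>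
    ⟨Finset.mem_product.2 ⟨Finset.mem_union_left _ (Finset.mem_union_left _ hz), Finset.mem_univ _⟩,
      Finset.mem_product.2 ⟨Finset.mem_union_left _ (Finset.mem_union_right _
        (Finset.mem_image_of_mem _ hz)), Finset.mem_univ _⟩,
      Finset.mem_product.2 ⟨Finset.mem_union_right _ (Finset.mem_image_of_mem _ hz), Finset.mem_univ _⟩,
      Finset.mem_product.2 ⟨Finset.mem_union_left _ (Finset.mem_union_left _ hz), Finset.mem_univ _⟩⟩
  exact analytic_torusLocalLimit_two_of_box ρ hρ hFS hFc hC hSE hS hE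

/-- **NO PHASE TRANSITION IN TWO DIMENSIONS.**  For every compact metrisable gauge group `G`, every continuous
representation `ρ` and every bounded continuous local observable `F` of `G^{edges(ℤ²)}` there is ONE function
`g : ℝ → ℝ`, real-analytic on all of `ℝ`, such that for every real `β` and every infinite-volume limit point `μ` at `β`
(there is exactly one, V-k): `∫ F dμ = g(β)` — the infinite-volume expectation of every local observable is analytic in the
coupling on the whole real line. -/
theorem exists_analytic_integral_eq_two (hρ : Continuous ρ) {F : LGConfig 2 G → ℝ} {S : Finset ((Literature.MathematicalPhysics.QuantumLattice.ZdEdge 2))}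
    (hFS : IsCylinder F S) (hFc : Continuous F) (hFb : ∃ C, ∀ U, |F U| ≤ C) :
    ∃ g : ℝ → ℝ, AnalyticOnNhd ℝ g Set.univ ∧ ∀ (β : ℝ) (μ : Measure (LGConfig 2 G)),
      μ ∈ infiniteVolumeLimitPoints ρ β → ∫ U, F U ∂μ = g β := by
  obtain ⟨g, hg, hlim⟩ := exists_analytic_torusLocalLimit_two ρ hρ hFS hFc hFb
  refine ⟨g, hg, fun β μ hμ => ?_⟩
  have hA : Tendsto (fun L : ℕ => wilsonExpectation (L := L + 1) ρ β (toTorusObservable (L + 1) F)) atTop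
      (𝓝 (∫ U, F U ∂μ)) := by
    simpa using (isInfiniteVolumeLimit_of_mem_two ρ hρ hμ).2 F S hFS hFc hFb
  exact tendsto_nhds_unique hA (hlim β)

end Analytic

end Summit.Ventures.LatticeQCDFlow.Scoring
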